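import Literature.AlgebraicGeometry.Motives.MixedHodgeExtensionHomEvaluation
import Literature.AlgebraicGeometry.Motives.MixedHodgeExtensionHomFunctorTranspose
import HarnessLib

/-!
# The classes of `Hom(C, x)`, `x ⊗ C`, `C ⊗ x`, `x^∨`, `Hom(x, C)` in Beilinson's `J⁰_W(Hom(·, ·))`

Brylinski–Zucker, *An overview of recent advances in Hodge theory*, Prop. 5.22 (after Beilinson and
Carlson): `Ext¹_MHS(A, B) ≅ J⁰_W Hom(A, B) = W₀Hom(A, B)_ℂ / ((F⁰ ∩ W₀) + W₀Hom(A, B)_ℚ)`, the tree's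
`Ext.extEquivJacobianWHom : Ext(A, B) ≃ J⁰_W(Hom(A, B))` (`MixedHodgeExtensionNonSeparatedInternalHom`).
Deligne–Milne, *Tannakian categories* §1 (1.6.1)–(1.6.4): the internal Hom is functorial, with internal
composition `Hom(Y, Z) ⊗ Hom(X, Y) → Hom(X, Z)` and the adjunction `− ⊗ X ⊣ Hom(X, −)`; Deligne, *Hodge II*
1.1.12; Carlson 1980, §2(b) Prop. 1 (functoriality of `Ext`), §2(c) Remark (3) (the dual extension,
class `-ψᵗ`).

This file computes, in the `J⁰_W(Hom)` model, the operations on `Ext¹` constructed in the tree, as the maps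
`J⁰_W(Φ)` induced by explicit MORPHISMS OF MIXED HODGE STRUCTURES `Φ` between internal Homs:

* §1 **naturality**: `J(g_* x) = J⁰_W(Hom(A, g))(J x)`, `J(f^* x) = J⁰_W(Hom(f, B))(J x)` (`J = extEquivJacobianWHom`);
* §2 the morphisms `homPostcomp C A B : Hom(A, B) → Hom(Hom(C, A), Hom(C, B))` (`f ↦ f ∘ −`, the curried
  internal composition), `homPrecomp A B C : Hom(A, B) → Hom(Hom(B, C), Hom(A, C))` (`f ↦ − ∘ f`),
  `rTensorHom A B C : Hom(A, B) → Hom(A ⊗ C, B ⊗ C)` (`f ↦ f ⊗ 1`), `lTensorHom C A B` (`f ↦ 1 ⊗ f`), with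
  their underlying maps, and `curry ∘ Hom(ev, B) = homPostcomp`;
* §3 **the class formulas**: `J(Hom(C, x)) = J⁰_W(homPostcomp)(J x)`, `J(x ⊗ C) = J⁰_W(rTensorHom)(J x)`,
  `J(C ⊗ x) = J⁰_W(lTensorHom)(J x)`, **`J(x^∨) = −J⁰_W(homTranspose)(J x)`** (Carlson's sign), and
  **`J(Hom(x, C)) = −J⁰_W(homPrecomp)(J x)`**.

All statements proved; no named facts.

## References

* [BrylinskiZucker1998] J.-L. Brylinski, S. Zucker, An overview of recent advances in Hodge theory, Prop. 5.22.
* [DeligneMilne1982Tannakian] P. Deligne, J. S. Milne, Tannakian categories, LNM 900 (1982), §1 Def. 1.6,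
  (1.6.1)–(1.6.4).
* [Carlson1980] J. A. Carlson, Extensions of mixed Hodge structures (1980), §2(b) Prop. 1, §2(c) Remark (3).
* [DeligneHodgeII1971] P. Deligne, Théorie de Hodge II, 1.1.12.
* [Jannsen1990MixedMotives] U. Jannsen, Mixed Motives and Algebraic K-Theory, LNM 1400 (1990), §9 Lemma 9.2,
  Remark 9.3 a).
-/

noncomputable section

open scoped TensorProduct

namespace Literature.AlgebraicGeometry.Motives

namespace MixedHodgeStructure

open HodgeStructure (tate homBaseChange homBaseChange_tmul)

variable {VA : Type*} [AddCommGroup VA] [Module ℚ VA] [FiniteDimensional ℚ VA]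
variable {VB : Type*} [AddCommGroup VB] [Module ℚ VB] [FiniteDimensional ℚ VB]
variable {VC : Type*} [AddCommGroup VC] [Module ℚ VC] [FiniteDimensional ℚ VC]
variable {VA' : Type*} [AddCommGroup VA'] [Module ℚ VA'] [FiniteDimensional ℚ VA']
variable {VB' : Type*} [AddCommGroup VB'] [Module ℚ VB'] [FiniteDimensional ℚ VB']

/-! ### §1 Naturality of `Ext(A, B) ≅ J⁰_W(Hom(A, B))` -/

namespace Ext

variable {A : MixedHodgeStructure VA} {B : MixedHodgeStructure VB}
variable {A' : MixedHodgeStructure VA'} {B' : MixedHodgeStructure VB'}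

/-- **`J(g_* x) = J⁰_W(Hom(A, g)) (J x)`**: the bijection `Ext(A, B) ≅ J⁰_W(Hom(A, B))` is natural in `B`.
[cite: BrylinskiZucker1998, Prop. 5.22] [cite: Carlson1980, §2(b) Prop. 1] -/
theorem extEquivJacobianWHom_pushoutMapW (g : Hom B B') (x : Ext A B) :
    extEquivJacobianWHom (pushoutMapW g x) = (Hom.homMap (Hom.id A) g).jacobianWMap (extEquivJacobianWHom x) := by
  rw [← unitEquivJacobianW_unitInternalHomEquivW_symm, unitInternalHomEquivW_symm_pushoutMapW,
    unitEquivJacobianW_pushoutMapW, unitEquivJacobianW_unitInternalHomEquivW_symm]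

/-- **`J(f^* x) = J⁰_W(Hom(f, B)) (J x)`**: naturality in `A` (contravariant).
[cite: BrylinskiZucker1998, Prop. 5.22] [cite: Carlson1980, §2(b) Prop. 1] -/
theorem extEquivJacobianWHom_pullbackMapW (f : Hom A' A) (x : Ext A B) :
    extEquivJacobianWHom (pullbackMapW f x) = (Hom.homMap f (Hom.id B)).jacobianWMap (extEquivJacobianWHom x) := by
  rw [← unitEquivJacobianW_unitInternalHomEquivW_symm, unitInternalHomEquivW_symm_pullbackMapW,
    unitEquivJacobianW_pushoutMapW, unitEquivJacobianW_unitInternalHomEquivW_symm]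

/-- `J(f^* g_* x) = J⁰_W(Hom(f, g)) (J x)`. [cite: BrylinskiZucker1998, Prop. 5.22] [cite: Carlson1980, §2(b) Prop. 1] -/
theorem extEquivJacobianWHom_pullbackMapW_pushoutMapW (f : Hom A' A) (g : Hom B B') (x : Ext A B) :
    extEquivJacobianWHom (pullbackMapW f (pushoutMapW g x)) =
      (Hom.homMap f g).jacobianWMap (extEquivJacobianWHom x) := by
  rw [← unitEquivJacobianW_unitInternalHomEquivW_symm, unitInternalHomEquivW_symm_pullbackMapW_pushoutMapW,
    unitEquivJacobianW_pushoutMapW, unitEquivJacobianW_unitInternalHomEquivW_symm]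

end Ext

/-! ### §2 The morphisms `f ↦ f ∘ −`, `f ↦ − ∘ f`, `f ↦ f ⊗ 1`, `f ↦ 1 ⊗ f` of internal Homs -/

section Morphisms

variable (A : MixedHodgeStructure VA) (B : MixedHodgeStructure VB) (C : MixedHodgeStructure VC)

/-- **`Hom(A, B) → Hom(Hom(C, A), Hom(C, B))`, `f ↦ (g ↦ f ∘ g)`**: the curried internal composition
`Hom(A, B) ⊗ Hom(C, A) → Hom(C, B)` (the tree's `homComp`). [cite: DeligneMilne1982Tannakian, §1 Def. 1.6]
[cite: DeligneHodgeII1971, 1.1.12] -/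
def homPostcomp : Hom (hom A B) (hom (hom C A) (hom C B)) :=
  curryHom (hom C A) (hom C B) (homComp C A B)

/-- `homPostcomp f g = f ∘ g`. [cite: DeligneMilne1982Tannakian, §1 Def. 1.6] -/
@[simp]
theorem homPostcomp_toLinearMap_apply (f : VA →ₗ[ℚ] VB) (g : VC →ₗ[ℚ] VA) :
    (homPostcomp A B C).toLinearMap f g = f ∘ₗ g := by
  rw [homPostcomp, curryHom_toLinearMap_apply, homComp_apply_tmul]

/-- **`Hom(A, B) → Hom(Hom(B, C), Hom(A, C))`, `f ↦ (g ↦ g ∘ f)`**: the curried internal composition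
`Hom(A, B) ⊗ Hom(B, C) ≅ Hom(B, C) ⊗ Hom(A, B) → Hom(A, C)`. [cite: DeligneMilne1982Tannakian, §1 Def. 1.6]
[cite: DeligneHodgeII1971, 1.1.12] -/
def homPrecomp : Hom (hom A B) (hom (hom B C) (hom A C)) :=
  curryHom (hom B C) (hom A C) ((homComp A B C).comp (tensorComm (hom A B) (hom B C)))

/-- `homPrecomp f g = g ∘ f`. [cite: DeligneMilne1982Tannakian, §1 Def. 1.6] -/
@[simp]
theorem homPrecomp_toLinearMap_apply (f : VA →ₗ[ℚ] VB) (g : VB →ₗ[ℚ] VC) :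
    (homPrecomp A B C).toLinearMap f g = g ∘ₗ f := by
  rw [homPrecomp, curryHom_toLinearMap_apply, Hom.comp_toLinearMap, LinearMap.comp_apply, tensorComm_toLinearMap,
    LinearEquiv.coe_coe, TensorProduct.comm_tmul, homComp_apply_tmul]

/-- **`Hom(A, B) → Hom(A ⊗ C, B ⊗ C)`, `f ↦ f ⊗ 1_C`**: `uncurry ∘ Hom(A, coev_{B,C})`
(`a ⊗ c ↦ f(a) ⊗ c`). [cite: DeligneMilne1982Tannakian, §1 (1.6.1)] [cite: DeligneHodgeII1971, 1.1.12] -/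
def rTensorHom : Hom (hom A B) (hom (tensor A C) (tensor B C)) :=
  (homTensorUncurry A C (tensor B C)).comp (Hom.homMap (Hom.id A) (tensorCoev B C))

/-- `rTensorHom f = f ⊗ 1`. [cite: DeligneHodgeII1971, 1.1.12] -/
@[simp]
theorem rTensorHom_toLinearMap_apply (f : VA →ₗ[ℚ] VB) :
    (rTensorHom A B C).toLinearMap f = TensorProduct.map f (LinearMap.id : VC →ₗ[ℚ] VC) :=
  TensorProduct.ext' fun a c => by
    rw [rTensorHom, Hom.comp_toLinearMap, LinearMap.comp_apply, homTensorUncurry_toLinearMap_apply_tmul,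
      Hom.homMap_toLinearMap_apply, LinearMap.comp_apply, LinearMap.comp_apply, Hom.id_toLinearMap,
      LinearMap.id_apply, tensorCoev_toLinearMap_apply, TensorProduct.map_tmul, LinearMap.id_apply]

/-- **`Hom(A, B) → Hom(C ⊗ A, C ⊗ B)`, `f ↦ 1_C ⊗ f`**: `Hom(σ_{C,A}, σ_{B,C}) ∘ (· ⊗ 1_C)`.
[cite: DeligneMilne1982Tannakian, §1 (1.6.1)] [cite: DeligneHodgeII1971, 1.1.12] -/
def lTensorHom : Hom (hom A B) (hom (tensor C A) (tensor C B)) :=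
  ((Hom.homMap (tensorComm C A) (Hom.id (tensor C B))).comp
    (Hom.homMap (Hom.id (tensor A C)) (tensorComm B C))).comp (rTensorHom A B C)

/-- `lTensorHom f = 1 ⊗ f`. [cite: DeligneHodgeII1971, 1.1.12] -/
@[simp]
theorem lTensorHom_toLinearMap_apply (f : VA →ₗ[ℚ] VB) :
    (lTensorHom A B C).toLinearMap f = TensorProduct.map (LinearMap.id : VC →ₗ[ℚ] VC) f :=
  TensorProduct.ext' fun c a => by
    rw [lTensorHom, Hom.comp_toLinearMap, Hom.comp_toLinearMap, LinearMap.comp_apply, LinearMap.comp_apply,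
      rTensorHom_toLinearMap_apply, Hom.homMap_toLinearMap_apply, Hom.homMap_toLinearMap_apply, Hom.id_toLinearMap,
      Hom.id_toLinearMap, LinearMap.id_comp, LinearMap.comp_id, LinearMap.comp_apply, LinearMap.comp_apply,
      tensorComm_toLinearMap, tensorComm_toLinearMap, LinearEquiv.coe_coe, LinearEquiv.coe_coe,
      TensorProduct.comm_tmul, TensorProduct.map_tmul, TensorProduct.comm_tmul, TensorProduct.map_tmul,
      LinearMap.id_apply]

/-- **`curry ∘ Hom(ev_{C,A}, B) = homPostcomp`**: `curry(f ∘ ev) = (g ↦ (c ↦ f(g(c)))) = (g ↦ f ∘ g)`.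
[cite: DeligneMilne1982Tannakian, §1 Def. 1.6 and (1.6.3)] -/
theorem homTensorCurry_comp_homMap_homEval :
    (homTensorCurry (hom C A) C B).comp (Hom.homMap (homEval C A) (Hom.id B)) = homPostcomp A B C :=
  Hom.ext (LinearMap.ext fun f => LinearMap.ext fun g => LinearMap.ext fun c => by
    rw [Hom.comp_toLinearMap, LinearMap.comp_apply, homTensorCurry_toLinearMap_apply, Hom.homMap_toLinearMap_apply,
      LinearMap.comp_apply, LinearMap.comp_apply, homEval_apply_tmul, Hom.id_toLinearMap, LinearMap.id_apply,
      homPostcomp_toLinearMap_apply, LinearMap.comp_apply])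

/-- **`Hom(Hom(B,C), ᵗ⁻¹_{A,C}) ∘ Hom(ᵗ_{B,C}, ·) ∘ homPostcomp_{C^∨} ∘ ᵗ_{A,B} = homPrecomp`**:
`g ↦ ᵗ⁻¹(ᵗf ∘ ᵗg) = ᵗ⁻¹(ᵗ(g ∘ f)) = g ∘ f`. [cite: DeligneMilne1982Tannakian, §1 Def. 1.6] [cite: Carlson1980, §2(c) Remark (3)] -/
theorem homMap_homTransposeInv_comp_eq_homPrecomp :
    (((Hom.homMap (Hom.id (hom B C)) (homTransposeInv A C)).comp
        (Hom.homMap (homTranspose B C) (Hom.id (hom C.dual A.dual)))).comp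
      (homPostcomp B.dual A.dual C.dual)).comp (homTranspose A B) = homPrecomp A B C :=
  Hom.ext (LinearMap.ext fun f => LinearMap.ext fun g => by
    simp only [Hom.comp_toLinearMap, LinearMap.comp_apply, homTranspose_toLinearMap_apply,
      Hom.homMap_toLinearMap_apply, Hom.id_toLinearMap, LinearMap.comp_id, LinearMap.id_comp,
      homPostcomp_toLinearMap_apply, LinearMap.dualMap_comp_dualMap, homTransposeInv_toLinearMap_dualMap,
      homPrecomp_toLinearMap_apply])

end Morphisms

/-! ### §3 The class formulas in `J⁰_W(Hom)` -/

section Transpose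

variable (A : MixedHodgeStructure VA) (B : MixedHodgeStructure VB)

/-- `Hom(A, B)_ℂ ≅ Hom_ℂ(A_ℂ, B_ℂ)` intertwines `ᵗ ⊗ ℂ` with the transpose of `ℂ`-linear maps (`ctranspose`):
on `c ⊗ f` both give `c • (ᵗf)_ℂ`. [cite: Carlson1980, §2(c) Remark (3)] -/
theorem homBaseChange_homTranspose_baseChange (h : ℂ ⊗[ℚ] (VA →ₗ[ℚ] VB)) :
    homBaseChange (Module.Dual ℚ VB) (Module.Dual ℚ VA) ((homTranspose A B).toLinearMap.baseChange ℂ h) =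
      ctranspose (homBaseChange VA VB h) := by
  induction h using TensorProduct.induction_on with
  | zero => simp only [map_zero]
  | add x y hx hy => simp only [map_add, hx, hy]
  | tmul c f =>
    rw [LinearMap.baseChange_tmul, homTranspose_toLinearMap_apply, homBaseChange_tmul, homBaseChange_tmul,
      map_smul, ctranspose_baseChange]

/-- **Under `J⁰_W(Hom(A, B)) ≅ J⁰W₀Hom(A, B)` the map `J⁰_W(ᵗ)` is Brylinski–Zucker's transpose `transposeW`.**
[cite: BrylinskiZucker1998, Prop. 5.22] [cite: Carlson1980, §2(c) Remark (3)] -/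
theorem jacobianWHomEquivJHomW_jacobianWMap_homTranspose (c : (hom A B).jacobianW) :
    jacobianWHomEquivJHomW B.dual A.dual ((homTranspose A B).jacobianWMap c) =
      JHomW.transposeW A B (jacobianWHomEquivJHomW A B c) := by
  obtain ⟨ξ, rfl⟩ := (hom A B).toJacobianW_surjective c
  apply Subtype.ext
  rw [Hom.jacobianWMap_toJacobianW, coe_jacobianWHomEquivJHomW_toJacobianW]
  change _ = JHomW.transposeWQuot A B ((jacobianWHomEquivJHomW A B ((hom A B).toJacobianW ξ) : JHomW A B) :
    JWQuot A B)
  rw [coe_jacobianWHomEquivJHomW_toJacobianW, JHomW.transposeWQuot_mk]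
  exact congrArg _ (homBaseChange_homTranspose_baseChange A B _)

end Transpose

namespace Ext

variable {A : MixedHodgeStructure VA} {B : MixedHodgeStructure VB} (C : MixedHodgeStructure VC)

/-- **`J(Hom(C, x)) = J⁰_W(f ↦ f ∘ −)(J x)`**: the class of `Hom(C, E)` in `J⁰_W(Hom(Hom(C, A), Hom(C, B)))` is
the image of the class of `E` under the morphism of MHS `Hom(A, B) → Hom(Hom(C, A), Hom(C, B))`
(from `Hom(C, x) = adj((ev)^* x)` and `J ∘ adj = J⁰_W(curry) ∘ J`). [cite: BrylinskiZucker1998, Prop. 5.22]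
[cite: DeligneMilne1982Tannakian, §1 (1.6.1)] -/
theorem extEquivJacobianWHom_homLeftMap (x : Ext A B) :
    extEquivJacobianWHom (homLeftMap C x) = (homPostcomp A B C).jacobianWMap (extEquivJacobianWHom x) := by
  rw [homLeftMap_eq_tensorHomAdj_pullbackMapW_homEval, extEquivJacobianWHom_tensorHomAdj,
    extEquivJacobianWHom_pullbackMapW, ← LinearMap.comp_apply, ← Hom.jacobianWMap_comp,
    homTensorCurry_comp_homMap_homEval]

/-- **`J(x ⊗ C) = J⁰_W(f ↦ f ⊗ 1)(J x)`** (from `x ⊗ C = adj⁻¹((coev)_* x)` and `J ∘ adj⁻¹ = J⁰_W(uncurry) ∘ J`).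
[cite: BrylinskiZucker1998, Prop. 5.22] [cite: Jannsen1990MixedMotives, §9 Remark 9.3 a)] -/
theorem extEquivJacobianWHom_rTensorMap (x : Ext A B) :
    extEquivJacobianWHom (rTensorMap C x) = (rTensorHom A B C).jacobianWMap (extEquivJacobianWHom x) := by
  rw [rTensorMap_eq_tensorHomAdj_symm_pushoutMapW_tensorCoev, extEquivJacobianWHom_tensorHomAdj_symm,
    extEquivJacobianWHom_pushoutMapW, ← LinearMap.comp_apply, ← Hom.jacobianWMap_comp]
  rfl

/-- **`J(C ⊗ x) = J⁰_W(f ↦ 1 ⊗ f)(J x)`.** [cite: BrylinskiZucker1998, Prop. 5.22] [cite: Jannsen1990MixedMotives, §9 Remark 9.3 a)] -/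
theorem extEquivJacobianWHom_lTensorMap (x : Ext A B) :
    extEquivJacobianWHom (lTensorMap C x) = (lTensorHom A B C).jacobianWMap (extEquivJacobianWHom x) := by
  rw [lTensorMap_def, extEquivJacobianWHom_pullbackMapW, extEquivJacobianWHom_pushoutMapW,
    extEquivJacobianWHom_rTensorMap, ← LinearMap.comp_apply, ← LinearMap.comp_apply, ← Hom.jacobianWMap_comp,
    ← Hom.jacobianWMap_comp]
  rfl

/-- **`J(x^∨) = −J⁰_W(ᵗ)(J x)`**: in the `J⁰_W(Hom)` model the dual-extension bijection
`Ext(A, B) ≅ Ext(B^∨, A^∨)` is MINUS the map induced by the transposition `Hom(A, B) → Hom(B^∨, A^∨)`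
(Carlson: `ψ̂ = −ψᵗ`). [cite: Carlson1980, §2(c) Remark (3)] [cite: BrylinskiZucker1998, Prop. 5.22] -/
theorem extEquivJacobianWHom_dualEquivW (x : Ext A B) :
    extEquivJacobianWHom (dualEquivW x) = -((homTranspose A B).jacobianWMap (extEquivJacobianWHom x)) := by
  apply (jacobianWHomEquivJHomW B.dual A.dual).injective
  rw [jacobianWHomEquivJHomW_extEquivJacobianWHom, clsW_dualEquivW, map_neg,
    jacobianWHomEquivJHomW_jacobianWMap_homTranspose, jacobianWHomEquivJHomW_extEquivJacobianWHom]

/-- **`J(Hom(x, C)) = −J⁰_W(f ↦ − ∘ f)(J x)`**: the class of `Hom(E, C)` in `J⁰_W(Hom(Hom(B, C), Hom(A, C)))` is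
MINUS the image of the class of `E` under the morphism `Hom(A, B) → Hom(Hom(B, C), Hom(A, C))` (the sign is
Carlson's `[E^∨] = −ᵗ[E]`; from `Hom(x, C) = (ᵗ⁻¹)_* (ᵗ)^* Hom(C^∨, x^∨)`).
[cite: Carlson1980, §2(c) Remark (3)] [cite: BrylinskiZucker1998, Prop. 5.22] -/
theorem extEquivJacobianWHom_homRightMap (x : Ext A B) :
    extEquivJacobianWHom (homRightMap C x) = -((homPrecomp A B C).jacobianWMap (extEquivJacobianWHom x)) := by
  have h1 := extEquivJacobianWHom_homLeftMap C.dual (dualEquivW x)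
  rw [extEquivJacobianWHom_dualEquivW, map_neg] at h1
  rw [homRightMap_eq_pushoutMapW_pullbackMapW_homLeftMap_dual, extEquivJacobianWHom_pushoutMapW,
    extEquivJacobianWHom_pullbackMapW, h1, map_neg, map_neg, ← LinearMap.comp_apply, ← LinearMap.comp_apply,
    ← LinearMap.comp_apply, ← Hom.jacobianWMap_comp, ← Hom.jacobianWMap_comp, ← Hom.jacobianWMap_comp,
    homMap_homTransposeInv_comp_eq_homPrecomp]

/-- On classes of extensions: `clsJacobianW (Hom(C, E)) = J⁰_W(f ↦ f ∘ −)(clsJacobianW E)`.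
[cite: BrylinskiZucker1998, Prop. 5.22] -/
theorem extEquivJacobianWHom_homLeftMap_mkOfW {VE : Type*} [AddCommGroup VE] [Module ℚ VE]
    [FiniteDimensional ℚ VE] (E : Extension A B VE) :
    extEquivJacobianWHom (mkOfW (E.homLeft C)) = (homPostcomp A B C).jacobianWMap (extEquivJacobianWHom (mkOfW E)) := by
  rw [← homLeftMap_mkOfW, extEquivJacobianWHom_homLeftMap]

/-- On classes of extensions: `clsJacobianW (E ⊗ C) = J⁰_W(f ↦ f ⊗ 1)(clsJacobianW E)`.
[cite: BrylinskiZucker1998, Prop. 5.22] -/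
theorem extEquivJacobianWHom_rTensorMap_mkOfW {VE : Type*} [AddCommGroup VE] [Module ℚ VE]
    [FiniteDimensional ℚ VE] (E : Extension A B VE) :
    extEquivJacobianWHom (mkOfW (E.rTensor C)) = (rTensorHom A B C).jacobianWMap (extEquivJacobianWHom (mkOfW E)) := by
  rw [← rTensorMap_mkOfW, extEquivJacobianWHom_rTensorMap]

end Ext

end MixedHodgeStructure

end Literature.AlgebraicGeometry.Motives

end
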